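import Summits.KontsevichZagierPeriods.KontsevichZagierPeriods.Theorems.TerasomaMultiplicationBetaCancellationStubFmcDescent
import Literature.NumberTheory.Transcendental.KZProductIdeal
import Literature.NumberTheory.Transcendental.SemialgebraicMapsProofs

/-!
# A one-bijection form IS a certificate: `[K × A] − [K × B] ∈ relations`

Line `divisor-slicing-transshipment` of crux `BetaCancellation` (stmt-KontsevichZagierPeriods-13633).
The converse bookkeeping of the one-bijection normal form (`stub_tameForm`): if the catalytic products
`K × A`, `K × B` (`K = [ℝ, 1/(1+x²)]`) are related by a finite piecewise `ℚ`-semialgebraic measure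
isomorphism — pieces `S j ⊆ ℝ × A.domain`, injective differentiable `ℚ`-semialgebraic maps `Ψ j`
into `ℝ × B.domain` with the Jacobian identity `k(z₀)A(tail z) = k((Ψz)₀)B(tail Ψz)|det Ψ'|`,
pieces and images pairwise a.e. disjoint and a.e. covering — then `[K × A] − [K × B]` is a relation
of the Kontsevich–Zagier calculus: the pieces are a finite measured correspondence in dimension
`1 + d` with the product densities as weights, and `stub_fmcDescent` applies verbatim. With
`KZ.PiCancellation` this gives `A ∼ B`; the open converse direction of the line is exactly the
descent WITHOUT `PiCancellation`.
-/

noncomputable section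

set_option linter.dupNamespace false

open MeasureTheory Set Filter
open Literature.NumberTheory.Transcendental
open Literature.NumberTheory.Transcendental.KZ
open Literature.ModelTheory.ExponentialFields (IsSemialgebraic isSemialgebraic_univ)

namespace Summit.KontsevichZagierPeriods.KontsevichZagierPeriods.BetaCancellationDivisorSlicing

/-- **An a.e. partition sums indicators to the function**: if finitely many sets `S j` cover `D`
a.e. and overlap pairwise only in null sets, then `∑ⱼ 𝟙_{S j} f = f` a.e. on `D`. [folklore] -/
theorem sum_indicator_ae_eq_of_ae_partition {N J : ℕ} {D : Set (Fin N → ℝ)} (hD : MeasurableSet D)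
    {S : Fin J → Set (Fin N → ℝ)} (hdisj : ∀ j j', j ≠ j' → volume (S j ∩ S j') = 0)
    (hcov : volume (D \ ⋃ j, S j) = 0) (f : (Fin N → ℝ) → ℝ) :
    (fun z => ∑ j, (S j).indicator f z) =ᵐ[volume.restrict D] f := by
  have h1 : ∀ᵐ z ∂volume, z ∉ D \ ⋃ j, S j := measure_eq_zero_iff_ae_notMem.1 hcov
  have h2 : ∀ᵐ z ∂volume, ∀ j j', j ≠ j' → z ∉ S j ∩ S j' := by
    rw [ae_all_iff]; intro j
    rw [ae_all_iff]; intro j'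
    by_cases hjj : j = j'
    · exact Eventually.of_forall fun z h => (h hjj).elim
    · filter_upwards [measure_eq_zero_iff_ae_notMem.1 (hdisj j j' hjj)] with z hz _ using hz
  rw [EventuallyEq, ae_restrict_iff' hD]
  filter_upwards [h1, h2] with z hz1 hz2 hzD
  have hzU : z ∈ ⋃ j, S j := by
    by_contra h
    exact hz1 ⟨hzD, h⟩
  obtain ⟨j₀, hj₀⟩ := mem_iUnion.1 hzU
  rw [Finset.sum_eq_single j₀]
  · exact indicator_of_mem hj₀ f
  · intro j _ hj
    have : z ∉ S j := fun hzj => hz2 j j₀ hj ⟨hzj, hj₀⟩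
    exact indicator_of_notMem this f
  · intro h; exact (h (Finset.mem_univ j₀)).elim

/-- **Registered sub-goal `oneBijection_prod_sub_prod_mem_relations`** (crux stmt-KontsevichZagierPeriods-13633,
line `divisor-slicing-transshipment`): a one-bijection form between the catalytic products `K × A` and
`K × B` (`K` the Cauchy line) is itself a certificate, `[K × A] − [K × B] ∈ KZ.relations` — by
`stub_fmcDescent` in dimension `1 + d` with the product densities as weights. [folklore] -/
theorem oneBijection_prod_sub_prod_mem_relations : ∀ (d : ℕ) (A B : IntegralRep d) (K : IntegralRep 1), K.domain = Set.univ → Set.EqOn K.integrand (fun x => 1 / (1 + x 0 ^ 2)) K.domain → ∀ (J : ℕ) (S : Fin J → Set (Fin (1 + d) → ℝ)) (Ψ : Fin J → (Fin (1 + d) → ℝ) → (Fin (1 + d) → ℝ)) (Ψ' : Fin J → (Fin (1 + d) → ℝ) → ((Fin (1 + d) → ℝ) →L[ℝ] (Fin (1 + d) → ℝ))), ((∀ j, IsSemialgebraic ℚ (S j) ∧ S j ⊆ {z | (fun i => z (Fin.natAdd 1 i)) ∈ A.domain} ∧ IsSemialgebraicMapOn ℚ (S j) (Ψ j) ∧ Set.InjOn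 (Ψ j) (S j) ∧ (∀ z ∈ S j, HasFDerivWithinAt (Ψ j) (Ψ' j z) (S j) z) ∧ Ψ j '' S j ⊆ {z | (fun i => z (Fin.natAdd 1 i)) ∈ B.domain} ∧ ∀ z ∈ S j, 1 / (1 + z (Fin.castAdd d 0) ^ 2) * A.integrand (fun i => z (Fin.natAdd 1 i)) = 1 / (1 + (Ψ j z) (Fin.castAdd d 0) ^ 2) * B.integrand (fun i => (Ψ j z) (Fin.natAdd 1 i)) * |(Ψ' j z).det|) ∧ (∀ j j', j ≠ j' → volume (S j ∩ S j') = 0 ∧ volume (Ψ j '' S j ∩ Ψ j' '' S j') = 0) ∧ volume ({z : Fin (1 + d) → ℝ | (fun i => z (Fin.natAdd 1 i)) ∈ A.domain} \ ⋃ j, S j) = 0 ∧ volume ({z : Fin (1 + d) → ℝ | (fun i => z (Fin.natAdd 1 i)) ∈ B.domain} \ ⋃ j, Ψ j '' S j) = 0) → of (K.prod A) - of (K.prod B) ∈ relations := by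
  intro d A B K hKd hKi J S Ψ Ψ' h
  obtain ⟨hΨ, hdisj, hcovA, hcovB⟩ := h
  -- the two product representations and their domains / integrands
  have hdomA : (K.prod A).domain = {z : Fin (1 + d) → ℝ | (fun i => z (Fin.natAdd 1 i)) ∈ A.domain} := by
    ext z
    simp only [IntegralRep.prod_domain, IntegralRep.mem_prodDomain, hKd, mem_univ, true_and,
      mem_setOf_eq]
  have hdomB : (K.prod B).domain = {z : Fin (1 + d) → ℝ | (fun i => z (Fin.natAdd 1 i)) ∈ B.domain} := by
    ext z
    simp only [IntegralRep.prod_domain, IntegralRep.mem_prodDomain, hKd, mem_univ, true_and,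
      mem_setOf_eq]
  have hintA : ∀ z, (K.prod A).integrand z =
      1 / (1 + z (Fin.castAdd d 0) ^ 2) * A.integrand (fun i => z (Fin.natAdd 1 i)) := by
    intro z
    rw [IntegralRep.prod_integrand_eq]
    show K.integrand _ * A.integrand _ = _
    rw [hKi (by rw [hKd]; exact mem_univ _)]
  have hintB : ∀ z, (K.prod B).integrand z =
      1 / (1 + z (Fin.castAdd d 0) ^ 2) * B.integrand (fun i => z (Fin.natAdd 1 i)) := by
    intro z
    rw [IntegralRep.prod_integrand_eq]
    show K.integrand _ * B.integrand _ = _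
    rw [hKi (by rw [hKd]; exact mem_univ _)]
  -- the finite measured correspondence: pieces `S j`, maps `Ψ j`, weights = product densities
  refine stub_fmcDescent (1 + d) (K.prod A) (K.prod B) J S Ψ Ψ'
    (fun _ => (K.prod A).integrand) (fun _ => (K.prod B).integrand) ?_ ?_ ?_ ?_ ?_
  · intro j
    exact ⟨(hΨ j).1, by rw [hdomA]; exact (hΨ j).2.1⟩
  · intro j
    exact ⟨(hΨ j).2.2.1, (hΨ j).2.2.2.1, (hΨ j).2.2.2.2.1, by rw [hdomB]; exact (hΨ j).2.2.2.2.2.1⟩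
  · intro j
    have hSsub : S j ⊆ (K.prod A).domain := by rw [hdomA]; exact (hΨ j).2.1
    have hIsub : Ψ j '' S j ⊆ (K.prod B).domain := by rw [hdomB]; exact (hΨ j).2.2.2.2.2.1
    have hIsa : IsSemialgebraic ℚ (Ψ j '' S j) :=
      IsSemialgebraicMapOn.isSemialgebraic_image_holds (hΨ j).2.2.1 subset_rfl (hΨ j).1
    refine ⟨(K.prod A).isSemialgebraicFunOn_integrand.mono hSsub (hΨ j).1,
      (K.prod A).integrableOn.mono_set hSsub,
      (K.prod B).isSemialgebraicFunOn_integrand.mono hIsub hIsa,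
      (K.prod B).integrableOn.mono_set hIsub, fun z hz => ?_⟩
    rw [hintA, hintB]
    exact (hΨ j).2.2.2.2.2.2 z hz
  · have hmeas : MeasurableSet (K.prod A).domain := IntegralRep.measurableSet_domain_holds _
    have hcov : volume ((K.prod A).domain \ ⋃ j, S j) = 0 := by rw [hdomA]; exact hcovA
    exact sum_indicator_ae_eq_of_ae_partition hmeas (fun j j' hjj => (hdisj j j' hjj).1) hcov _
  · have hmeas : MeasurableSet (K.prod B).domain := IntegralRep.measurableSet_domain_holds _
    have hcov : volume ((K.prod B).domain \ ⋃ j, Ψ j '' S j) = 0 := by rw [hdomB]; exact hcovB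
    exact sum_indicator_ae_eq_of_ae_partition hmeas (fun j j' hjj => (hdisj j j' hjj).2) hcov _

/-- **Descent from a one-bijection form, granted `KZ.PiCancellation`**: the (easy) converse
direction of the line — with the open conjecture `PiCancellation` (item 0540), a one-bijection form
`K × A ≅ K × B` gives `A ∼ B` (`oneBijection_prod_sub_prod_mem_relations`, the Cauchy line ∼ disc,
`Equivalent.prod`). CONDITIONAL on `KZ.PiCancellation`. [folklore] -/
theorem equivalent_of_oneBijection_of_piCancellation (hπ : KZ.PiCancellation) {d : ℕ}
    (A B : IntegralRep d) (K : IntegralRep 1) (hKπ : Equivalent K piRep)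
    (h : of (K.prod A) - of (K.prod B) ∈ relations) : Equivalent A B := by
  -- `[π]·([A] − [B]) ∈ relations` by trading the Cauchy line for the disc
  have hA : Equivalent (piRep.prod A) (K.prod A) := (hKπ.prod (Equivalent.refl A)).symm
  have hB : Equivalent (K.prod B) (piRep.prod B) := hKπ.prod (Equivalent.refl B)
  have hπAB : of (piRep.prod A) - of (piRep.prod B) ∈ relations := by
    have hsum := relations.add_mem (relations.add_mem hA h) hB
    have : of (piRep.prod A) - of (piRep.prod B) =
        of (piRep.prod A) - of (K.prod A) + (of (K.prod A) - of (K.prod B)) +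
          (of (K.prod B) - of (piRep.prod B)) := by abel
    rw [this]; exact hsum
  have hmul : of piRep * (of A - of B) ∈ relations := by
    rwa [mul_sub, of_mul_of, of_mul_of]
  exact hπ (of A - of B) hmul

end Summit.KontsevichZagierPeriods.KontsevichZagierPeriods.BetaCancellationDivisorSlicing

end
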